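import Summits.QuantumFields.BalabanUV.T4Continuum.Support.AveragingDeficitFermat
import HarnessLib

/-!
# NE7AxisHolonomyRecurrence — ON THE `m`-FOLD COVERS THE AXIS HOLONOMIES OF A PERIODIC UNITARY DATUM ARE THE POWERS `h_i^m`, AND THESE RETURN
# SIMULTANEOUSLY AND ARBITRARILY CLOSE TO `1` (Kronecker ∕ Poincaré recurrence in the compact group `U(n)^d`)

Cell `pub-balaban`, rung (B)+1 sub-cell t4, lineage `b2b-balaban-t4-ne7-p2`, generation 89 (CRUX PROVER NE7 #2 = co-owner of row NE7, kernel hand); file (R)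
of the gen-89 line «the (APE) END along the FLAT STRATUM by the cover trick».
WHY.  The cover trick (C1 `NE7TangentCriticalCover`, D9 `NE7ApeFlatToronEnd`) and the central twist (C4 `NE7CentralTwist`, D11 `NE7ApeFlatToronCentralEnd`) carry
the OWNER's END (D8, t4-ne7-p1 g74) to the fibre over every flat datum whose holonomy constants have FINITE ORDER modulo the centre.  For the remaining flat
data (infinite order) the covers still help, but only approximately: the `(N·m)`-fold axis holonomy of an `N`-periodic datum is the POWER `h_i^m` of its
period-`N` holonomy (`hol_seg_mul_eq_pow`), and in the compact group `U(n)^{d}` the powers of any element return to every neighbourhood of `1` — so on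
suitable covers the datum is within any prescribed `ε` of the finite-order situation (`exists_axis_holonomy_pow_near_one`).  This is the arithmetic input
of the one road to the infinite-order case that stays inside the periodic setting (a ROBUST END at almost-trivial holonomy + closedness of `SmallField`);
the robust END itself is NOT here.
WHAT ([folklore]; 0 def, 0 sorry).  §1 `norm_pow_sub_pow_eq_of_unitary` (`‖u^{a+m} − u^{a}‖ = ‖u^{m} − 1‖` for unitary `u`), **`exists_pow_sub_one_lt_of_unitary`**
(for a FINITE family of unitaries `h_i` and `ε > 0` there is `m ≥ 1` with `‖h_i^m − 1‖ < ε` for all `i` — Bolzano–Weierstrass in the proper space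
`ι → M_n(ℂ)` applied to `m ↦ (h_i^m)_i`, then one Cauchy step); §2 **`hol_seg_mul_eq_pow`** (`V([0,(P·m)e_i]) = V([0,P e_i])^m` for a `P`-periodic `V`),
**`exists_axis_holonomy_pow_near_one`** (for a unitary `N`-periodic datum `D` and `ε > 0`: `∃ m ≥ 1 ∀ i, ‖D([0,(N·m)e_i]) − 1‖ < ε`).
HONEST FRAMING (page 1): elementary ([folklore]); nothing of Bałaban's asserted; moves no letter by itself; the infinite-order flat data are NOT reached by
this file; (APE) on the data class NOT proved; NE7 NOT PRINTED ∕ NOT PROVED; spine PROVED 0∕9; FIXED FINITE T⁴, rung (B)+1 — NOT infinite volume, NOT mass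
gap, NOT BetaPertH, NOT Clay.  Continuum YM on T⁴ ⇐ BetaPertH ∧ nine spine estimates (0/9 proved); BetaPertH ⇐ (D1) ∧ (D4) ∧ CAP+tail; G-an2-4 gates asym,
D1 and NE2/3/4.
-/

set_option autoImplicit false

open scoped BigOperators Matrix.Norms.L2Operator
open NormedSpace Finset Filter Topology

namespace Summit.QuantumFields.BalabanUV.T4Continuum.NE7AxisHolonomyRecurrence

open Literature.MathematicalPhysics.QuantumFieldTheory.Balaban1983to89
open B7Prop1Explicit B7Prop2Explicit
open T4AveragingDeficitWall (IsUnitaryCfg)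
open T4AveragingDeficitWallBoundary (IsPeriodicCfg)
open AveragingDeficitFermat (hol_add_smul)

noncomputable section

variable {d : ℕ} {n : Type*} [Fintype n] [DecidableEq n]

/-! ## §1 Powers of unitaries return near `1`, simultaneously for a finite family -/

/-- `‖u^{a+m} − u^{a}‖ = ‖u^{m} − 1‖` for a unitary `u` (the C⋆-norm is invariant under right multiplication by unitaries). [folklore] -/
theorem norm_pow_sub_pow_eq_of_unitary {u : Matrix n n ℂ} (hu : u ∈ unitary (Matrix n n ℂ)) (a m : ℕ) :
    ‖u ^ (m + a) - u ^ a‖ = ‖u ^ m - 1‖ := by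
  have h : u ^ (m + a) - u ^ a = (u ^ m - 1) * u ^ a := by rw [pow_add, sub_mul, one_mul]
  rw [h, CStarRing.norm_mul_mem_unitary _ (pow_mem hu a)]

/-- **SIMULTANEOUS RECURRENCE OF POWERS IN `U(n)`**: for a finite family of unitaries `h_i` and `ε > 0` there is ONE exponent `m ≥ 1` with `‖h_i^m − 1‖ < ε`
for every `i` (Bolzano–Weierstrass for the bounded sequence `m ↦ (h_i^m)_i` in the proper space `ι → M_n(ℂ)`, then one Cauchy step and §1's invariance).
[folklore] -/
theorem exists_pow_sub_one_lt_of_unitary {ι : Type*} [Fintype ι] {h : ι → Matrix n n ℂ} (hh : ∀ i, h i ∈ unitary (Matrix n n ℂ))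
    {ε : ℝ} (hε : 0 < ε) : ∃ m : ℕ, 1 ≤ m ∧ ∀ i, ‖h i ^ m - 1‖ < ε := by
  classical
  -- the bounded sequence of power tuples
  let x : ℕ → (ι → Matrix n n ℂ) := fun m i => h i ^ m
  have hxb : ∀ m, x m ∈ Metric.closedBall (0 : ι → Matrix n n ℂ) 1 := by
    intro m
    rw [Metric.mem_closedBall, dist_zero_right]
    refine (pi_norm_le_iff_of_nonneg zero_le_one).2 fun i => ?_
    cases subsingleton_or_nontrivial (Matrix n n ℂ) with
    | inl hs => rw [Subsingleton.elim (x m i) 0, norm_zero]; exact zero_le_one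
    | inr hnt => exact (CStarRing.norm_of_mem_unitary (pow_mem (hh i) m)).le
  obtain ⟨a, -, φ, hφ, hlim⟩ := tendsto_subseq_of_bounded Metric.isBounded_closedBall hxb
  -- one Cauchy step along the subsequence
  have hε2 : 0 < ε / 2 := by positivity
  obtain ⟨N, hN⟩ := Metric.tendsto_atTop.1 hlim (ε / 2) hε2
  have hlt : φ N < φ (N + 1) := hφ (Nat.lt_succ_self N)
  refine ⟨φ (N + 1) - φ N, by omega, fun i => ?_⟩
  have hdist : dist (x (φ (N + 1))) (x (φ N)) < ε := by
    calc dist (x (φ (N + 1))) (x (φ N)) ≤ dist (x (φ (N + 1))) a + dist (x (φ N)) a := dist_triangle_right _ _ _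
      _ < ε / 2 + ε / 2 := add_lt_add (hN _ (Nat.le_succ N)) (hN _ le_rfl)
      _ = ε := by ring
  have hcomp : ‖x (φ (N + 1)) i - x (φ N) i‖ < ε := by
    rw [dist_eq_norm] at hdist
    exact (norm_le_pi_norm (x (φ (N + 1)) - x (φ N)) i).trans_lt hdist
  have hsplit : φ (N + 1) = (φ (N + 1) - φ N) + φ N := by omega
  have hx1 : x (φ (N + 1)) i = h i ^ ((φ (N + 1) - φ N) + φ N) := by
    show h i ^ φ (N + 1) = _
    rw [← hsplit]
  rw [hx1] at hcomp
  rwa [norm_pow_sub_pow_eq_of_unitary (hh i)] at hcomp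

/-! ## §2 The axis holonomies of a periodic datum on the `m`-fold covers -/

/-- Powers of an axis holonomy of a `P`-periodic configuration: `V([0,(P·m)e_i]) = V([0,P e_i])^m` ((9): segments concatenate, and the transport of a
periodic configuration is periodic in the base point). [folklore] -/
theorem hol_seg_mul_eq_pow {V : Site d → Fin d → (Matrix n n ℂ)ˣ} {P : ℕ} (hV : IsPeriodicCfg V (P : ℤ)) (i : Fin d) :
    ∀ m : ℕ, hol V 0 (seg i ((P * m : ℕ) : ℤ)) = hol V 0 (seg i (P : ℤ)) ^ m
  | 0 => by simp
  | m + 1 => by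
      have hcat : ∀ (p : Site d) (a b : ℕ),
          hol V p (seg i ((a + b : ℕ) : ℤ)) = hol V p (seg i (a : ℤ)) * hol V (p + (a : ℤ) • e i) (seg i (b : ℤ)) := by
        intro p a b
        rw [seg_natCast, seg_natCast, seg_natCast, List.replicate_add, hol_append, disp_replicate]
        simp [Letter.vec]
      rw [Nat.mul_succ, hcat, hol_seg_mul_eq_pow hV i m, pow_succ]
      congr 1
      have h := hol_add_smul hV 0 ((m : ℤ) • e i) (seg i (P : ℤ))
      rw [smul_smul] at h
      rw [show (((P * m : ℕ) : ℤ)) • e i = ((P : ℤ) * (m : ℤ)) • e i by push_cast; rfl, h]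

/-- **ON SUITABLE COVERS EVERY PERIODIC UNITARY DATUM HAS ALMOST-TRIVIAL AXIS HOLONOMIES**: for `D` unitary and `N`-periodic and `ε > 0` there is `m ≥ 1` with
`‖D([0,(N·m)e_i]) − 1‖ < ε` for every axis `i`. [folklore] -/
theorem exists_axis_holonomy_pow_near_one {N : ℕ} {D : Site d → Fin d → (Matrix n n ℂ)ˣ} (hDu : IsUnitaryCfg D) (hDP : IsPeriodicCfg D (N : ℤ))
    {ε : ℝ} (hε : 0 < ε) :
    ∃ m : ℕ, 1 ≤ m ∧ ∀ i : Fin d, ‖((hol D 0 (seg i ((N * m : ℕ) : ℤ)) : (Matrix n n ℂ)ˣ) : Matrix n n ℂ) - 1‖ < ε := by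
  have hh : ∀ i : Fin d, ((hol D 0 (seg i (N : ℤ)) : (Matrix n n ℂ)ˣ) : Matrix n n ℂ) ∈ unitary (Matrix n n ℂ) :=
    fun i => mem_unitaryUnits.1 (hol_mem_of hDu 0 (seg i (N : ℤ)))
  obtain ⟨m, hm, hmε⟩ := exists_pow_sub_one_lt_of_unitary hh hε
  refine ⟨m, hm, fun i => ?_⟩
  rw [hol_seg_mul_eq_pow hDP i m, Units.val_pow_eq_pow_val]
  exact hmε i

end

end Summit.QuantumFields.BalabanUV.T4Continuum.NE7AxisHolonomyRecurrence
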